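import Literature.Geometry.DiscreteGeometry.ThreePointKernelGeneral
import Summits.Ventures.PackingBounds.Energy.ChebyshevUExplicit
import Summits.Ventures.PackingBounds.Configurations.OrthogonalPentagons
import HarnessLib

/-!
# Ten points on `S³`, potential `(1+⟪x,y⟫)^3`: the two-point bound `95` is sharp (two orthogonal pentagons; every spherical 3-design)

Framing: lottery ticket; floor = certified bounds/negative ranges. Venture `PackingBounds`, cell
`pub-packcert`, energy family (pub-packcert-energy gen 14).

The case `k = 3` of the ten-point `(1+t)^k` problems on `S³` (Cohn–Woo 2012 §5.3) needs no three-point bound: `(1+t)^3 = 7/4 + (7/4)U₁ + (3/4)U₂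
+ (1/8)U₃` in the Chebyshev / Gegenbauer basis `C_k^1 = U_k` of `S³`, all coefficients nonnegative, so positive definiteness
(`pairSum_gegenbauer_comb_nonneg`) gives `Σ_{x≠y} (1+⟪x,y⟫)^3 ≥ 10²·7/4 - 10·8 = 95` for every ten unit vectors of `ℝ⁴`, with equality for
every spherical 3-design — in particular for two orthogonal regular pentagons (`Config.OrthogonalPentagons`): `ck3_ten_points`, `ck3_ten_points_isLeast`.
(For `k = 4, 5` see `TenPointCkFour/Five` (three-point, kernel), for `k ≥ 7` `TenPointPetersenAllK`.)
-/

noncomputable section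

open Finset
open scoped RealInnerProductSpace

namespace Summit.Ventures.PackingBounds.Energy.TenPointCkThree

open Literature.Geometry.DiscreteGeometry Literature.Geometry.DiscreteGeometry.BachocVallentin
open Literature.Analysis.SpecialFunctions Summit.Ventures.PackingBounds.Energy Summit.Ventures.PackingBounds.Config

/-- Coefficients of `(1+t)^3 - 7/4` in the basis `U_k = C_k^1`: `7/4, 3/4, 1/8` for `k = 1, 2, 3`. -/
def acoT3 : ℕ → ℝ
  | 1 => 7 / 4
  | 2 => 3 / 4
  | 3 => 1 / 8
  | _ => 0

/-- The coefficients are nonnegative. -/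
theorem aco_nonnegT3 (k : ℕ) : 0 ≤ acoT3 k := by
  unfold acoT3; split <;> norm_num

/-- `Σ_{k ≤ 3} aco_k U_k(w) = (1+w)^3 - 7/4`. -/
theorem aeval_T3 (w : ℝ) :
    (∑ k ∈ range (3 + 1), acoT3 k * gegenbauerSum ((((4 : ℕ) : ℝ) - 2) / 2) k w) = (1 + w) ^ 3 - 7 / 4 := by
  have hμ : ((((4 : ℕ) : ℝ) - 2) / 2) = (1 : ℝ) := by norm_num
  rw [hμ]
  have h0 : acoT3 0 = 0 := rfl
  have h1 : acoT3 1 = 7 / 4 := rfl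
  have h2 : acoT3 2 = 3 / 4 := rfl
  have h3 : acoT3 3 = 1 / 8 := rfl
  simp only [Finset.sum_range_succ, Finset.sum_range_zero, h0, h1, h2, h3, ChebyshevU.c1_0, ChebyshevU.c1_1,
    ChebyshevU.c1_2, ChebyshevU.c1_3]
  ring

/-- **Ten points on `S³`, `k = 3` (two-point bound).** For every ten unit vectors `C ⊂ ℝ⁴`: `Σ_{x ≠ y} (1 + ⟪x,y⟫)^3 ≥ 95`. -/
theorem ck3_ten_points (C : Finset (EuclideanSpace ℝ (Fin 4))) (hC : ∀ x ∈ C, ‖x‖ = 1) (h10 : C.card = 10) :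
    (95 : ℝ) ≤ ∑ x ∈ C, ∑ y ∈ C.erase x, (1 + inner ℝ x y) ^ 3 := by
  classical
  have hA := pairSum_gegenbauer_comb_nonneg (n := 4) (by norm_num) 3 acoT3 aco_nonnegT3 C hC
  simp only [BachocVallentin.pairSum, aeval_T3] at hA
  -- split off the diagonal terms ⟪x,x⟫ = 1
  have hdiag : ∀ x ∈ C, ∑ y ∈ C, ((1 + inner ℝ x y) ^ 3 - 7 / 4)
      = (8 - 7 / 4) + ∑ y ∈ C.erase x, ((1 + inner ℝ x y) ^ 3 - 7 / 4) := by
    intro x hx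
    rw [← Finset.add_sum_erase C _ hx, real_inner_self_eq_norm_sq, hC x hx]
    norm_num
  rw [Finset.sum_congr rfl hdiag, Finset.sum_add_distrib, Finset.sum_const, h10] at hA
  have hsplit : ∑ x ∈ C, ∑ y ∈ C.erase x, ((1 + inner ℝ x y) ^ 3 - 7 / 4)
      = ∑ x ∈ C, ∑ y ∈ C.erase x, (1 + inner ℝ x y) ^ 3 - ∑ x ∈ C, ∑ y ∈ C.erase x, (7 / 4 : ℝ) := by
    rw [← Finset.sum_sub_distrib]
    refine Finset.sum_congr rfl fun x _ => ?_
    rw [Finset.sum_sub_distrib]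
  have hconst : ∑ x ∈ C, ∑ y ∈ C.erase x, (7 / 4 : ℝ) = 10 * 9 * (7 / 4) := by
    rw [Finset.sum_congr rfl fun x hx => by rw [Finset.sum_const, Finset.card_erase_of_mem hx, h10]]
    rw [Finset.sum_const, h10]
    norm_num
  rw [hsplit, hconst] at hA
  norm_num at hA
  linarith

/-- Two orthogonal regular pentagons attain `95`. -/
theorem pentagons_ck3_energy : ∃ C : Finset (EuclideanSpace ℝ (Fin 4)), C.card = 10 ∧ (∀ x ∈ C, ‖x‖ = 1) ∧
    ∑ x ∈ C, ∑ y ∈ C.erase x, (1 + inner ℝ x y) ^ 3 = (95 : ℝ) := by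
  obtain ⟨C, hc, hn, _, he⟩ := OrthogonalPentagons.exists_config
  refine ⟨C, hc, hn, ?_⟩
  rw [he (fun t : ℝ => (1 + t) ^ 3)]
  have hX : Real.sqrt 5 ^ 2 = 5 := Real.sq_sqrt (by norm_num)
  have h4 : Real.sqrt 5 ^ 4 = 25 := by rw [show Real.sqrt 5 ^ 4 = (Real.sqrt 5 ^ 2) ^ 2 by ring, hX]; norm_num
  linear_combination (45 / 8 : ℝ) * hX + (0 : ℝ) * h4

/-- **Ten points on `S³`, `k = 3`, two-sided:** the least value of `Σ_{x ≠ y} (1+⟪x,y⟫)^3` over ten unit vectors of `ℝ⁴` is `95`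
(attained by two orthogonal regular pentagons, and by every ten-point spherical 3-design of `S³`). -/
theorem ck3_ten_points_isLeast :
    IsLeast {E : ℝ | ∃ C : Finset (EuclideanSpace ℝ (Fin 4)), C.card = 10 ∧ (∀ x ∈ C, ‖x‖ = 1) ∧
      E = ∑ x ∈ C, ∑ y ∈ C.erase x, (1 + inner ℝ x y) ^ 3} (95 : ℝ) := by
  obtain ⟨C0, hc0, hn0, he0⟩ := pentagons_ck3_energy
  refine ⟨⟨C0, hc0, hn0, he0.symm⟩, ?_⟩
  rintro E ⟨C, h10, hC, rfl⟩
  exact ck3_ten_points C hC h10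

end Summit.Ventures.PackingBounds.Energy.TenPointCkThree
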